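import Mathlib
import Summits.Ventures.PercRepro2.Defs
import Summits.Ventures.PercRepro2.Independence
import Summits.Ventures.PercRepro2.Harris
import Summits.Ventures.PercRepro2.Graph
import Summits.Ventures.PercRepro2.Exploration
import Summits.Ventures.PercRepro2.Events
import Summits.Ventures.PercRepro2.Induced
import Summits.Ventures.PercRepro2.R2PrimeThreeReduction
import Summits.Ventures.PercRepro2.YBridge
import Summits.Ventures.PercRepro2.HCov
import Summits.Ventures.PercRepro2.HubModel
import Summits.Ventures.PercRepro2.HubModel3
import Summits.Ventures.PercRepro2.HubLaw3
import Summits.Ventures.PercRepro2.HubBundle3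
import Summits.Ventures.PercRepro2.HubEvents3
import Summits.Ventures.PercRepro2.HubBern3

/-!
# The covariance form `Gc` on the class R₃ as a cubic in Bernstein-1 forms
(blind cell PercRepro2, mine-2 g17; MINE2-A3FIRST.md §3, §8 — typer-1's `HubGc` with the roles
of `a₃` and the roots exchanged)

Every mass of `CovForm.Gc` (HCov.lean) is the probability of a Boolean combination of the
connection events between the five marks, hence of a hub event of the a₃-hub (`toEvent3`); every
*signed* combination of such masses is the Bernstein-1 form `massZ3 q Φ m = bform q (tableZ3 Φ m)`
of a **ℤ-valued hub function** `Φ : HubFn3`. With the twelve hub functions `fQ3, fPD3, fDo3, fgap3,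
fEQbo3, fEQb33, fEQb3o3, fEQo3, fEQ33, fEQ3o3, fPDb3, fPDbo3` the form becomes (`Gc_eq_GcB3`, for an
injective marking of the class R₃) `Gc = GcB3 q m` with `q = bundleWeight3` the four a₃-bundle
weights and `m_π = P(Π = π)` the inner masses — eight products of three Bernstein-1 forms, which
regroup (`bform_mul_mul`) into `GcB3 q m = Σ_k bern q k · Ck3 m k` (`GcB3_eq_sum`) with the
coefficient cubics `Ck3 m k = cub3 (Wtot3 k) m`, `Wtot3 k` = the signed sum of the eight integer hub
tables `wZ3` = the a₃-hub table `W_k(π¹, π², π³)` of MINE2-A3FIRST.md §3 (type vectors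
`k ∈ {0,1,2,3}^4`); `GcB3_nonneg`: `0 ≤ GcB3 q m` once `q ∈ [0, 1]^4` and every `Ck3 m k ≥ 0`.
-/

namespace Summit.Ventures.PercRepro2.Hub3

open Hub UnionCluster

variable {V : Type*} {E : Type*}

/-- The marking of the five marks by five vertices. -/
def markOf3 (o a₁ a₂ a₃ b : V) : Mark → V
  | .o => o
  | .a₁ => a₁
  | .a₂ => a₂
  | .a₃ => a₃
  | .b => b

section HubFn

variable {R : Type*} [CommRing R]

/-- A ℤ-valued hub function: a signed combination of hub events. -/
abbrev HubFn3 := (Fin 4 → Bool) → (Fin 6 → Bool) → ℤ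

/-- The indicator of a hub event. -/
def ind3 (Ψ : HubEvt3) : HubFn3 := fun w π => if Ψ w π then 1 else 0

/-- The coefficient table of a hub function with inner masses `m`: `Σ_π Φ w π · m_π`. -/
def tableZ3 (Φ : HubFn3) (m : (Fin 6 → Bool) → R) : (Fin 4 → Bool) → R :=
  fun w => ∑ π, (Φ w π : R) * m π

/-- The table of an indicator is the table of the event. -/
lemma tableZ3_ind (Ψ : HubEvt3) (m : (Fin 6 → Bool) → R) : tableZ3 (ind3 Ψ) m = tableOf3 Ψ m := by
  funext w
  unfold tableZ3 tableOf3 ind3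
  refine Finset.sum_congr rfl fun π _ => ?_
  split_ifs <;> simp

/-- Tables are additive. -/
lemma tableZ3_add (Φ₁ Φ₂ : HubFn3) (m : (Fin 6 → Bool) → R) :
    tableZ3 (Φ₁ + Φ₂) m = tableZ3 Φ₁ m + tableZ3 Φ₂ m := by
  funext w
  simp only [tableZ3, Pi.add_apply, Int.cast_add, add_mul, Finset.sum_add_distrib]

/-- Tables are subtractive. -/
lemma tableZ3_sub (Φ₁ Φ₂ : HubFn3) (m : (Fin 6 → Bool) → R) :
    tableZ3 (Φ₁ - Φ₂) m = tableZ3 Φ₁ m - tableZ3 Φ₂ m := by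
  funext w
  simp only [tableZ3, Pi.sub_apply, Int.cast_sub, sub_mul, Finset.sum_sub_distrib]

/-- The Bernstein-1 mass of a hub function: `bform q (tableZ3 Φ m)`. -/
def massZ3 (q : Fin 4 → R) (Φ : HubFn3) (m : (Fin 6 → Bool) → R) : R := bform q (tableZ3 Φ m)

/-- Masses are additive. -/
lemma massZ3_add (q : Fin 4 → R) (Φ₁ Φ₂ : HubFn3) (m : (Fin 6 → Bool) → R) :
    massZ3 q (Φ₁ + Φ₂) m = massZ3 q Φ₁ m + massZ3 q Φ₂ m := by
  rw [massZ3, massZ3, massZ3, tableZ3_add, bform_add]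

/-- Masses are subtractive. -/
lemma massZ3_sub (q : Fin 4 → R) (Φ₁ Φ₂ : HubFn3) (m : (Fin 6 → Bool) → R) :
    massZ3 q (Φ₁ - Φ₂) m = massZ3 q Φ₁ m - massZ3 q Φ₂ m := by
  rw [massZ3, massZ3, massZ3, tableZ3_sub, bform_sub]

end HubFn

section Events

/-- `{s ↮ x}` is the complement of the connection event. -/
lemma avoidAll_singleton_eq3 (ends : E → Sym2 V) (s x : V) :
    avoidAll ends s {x} = (connEvent ends s x)ᶜ := by
  ext ω
  simp only [avoidAll, Set.mem_setOf_eq, Finset.mem_singleton, forall_eq, Set.mem_compl_iff,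
    mem_connEvent]

variable {R : Type*} [CommRing R] [Fintype E] [DecidableEq E] [DecidableEq V]
  {ends : E → Sym2 V} {μ : Mark → V}

/-- **The probability of a hub event is the mass of its indicator.** -/
theorem prob_toEvent3_eq_massZ3 (hinj : Function.Injective μ) (p : E → R)
    (m : (Fin 6 → Bool) → R) (hm : ∀ π, prob p {ω | innerPat3 ends μ ω = π} = m π) (Ψ : HubEvt3) :
    prob p (toEvent3 ends μ Ψ) = massZ3 (bundleWeight3 p ends μ) (ind3 Ψ) m := by
  rw [massZ3, tableZ3_ind, prob_toEvent3_eq_bform hinj p Ψ m hm]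

end Events

section Forms

/-- The connection hub event of two marks. -/
def cE3 (u v : Mark) : HubEvt3 := fun w π => reachOf3 w π u v

/-- `Q = {a₁ ↮ a₂}`. -/
def hQ3 : HubEvt3 := fun w π => !reachOf3 w π .a₂ .a₁

/-- `T = {a₁ ∉ C₂, a₃ ∈ C₂}`. -/
def hT3 : HubEvt3 := fun w π => !reachOf3 w π .a₂ .a₁ && reachOf3 w π .a₂ .a₃

/-- `T′ = {a₂ ∉ C₁, a₃ ∈ C₁}`. -/
def hT'3 : HubEvt3 := fun w π => !reachOf3 w π .a₁ .a₂ && reachOf3 w π .a₁ .a₃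

/-- `PD = {C₁ ≠ C₂, a₃ ∉ Ũ}`. -/
def hPD3 : HubEvt3 := fun w π =>
  !reachOf3 w π .a₁ .a₂ && !(reachOf3 w π .a₃ .a₁ || reachOf3 w π .a₃ .a₂)

/-- Conjunction of hub events. -/
def hand3 (Ψ₁ Ψ₂ : HubEvt3) : HubEvt3 := fun w π => Ψ₁ w π && Ψ₂ w π

/-- `{o ∈ C₁}`. -/
def o13 : HubEvt3 := cE3 .a₁ .o
/-- `{o ∈ C₂}`. -/
def o23 : HubEvt3 := cE3 .a₂ .o
/-- `{b ∈ C₁}`. -/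
def b13 : HubEvt3 := cE3 .a₁ .b
/-- `{b ∈ C₂}`. -/
def b23 : HubEvt3 := cE3 .a₂ .b

/-- `P(Q)`. -/
def fQ3 : HubFn3 := ind3 hQ3
/-- `P(PD)`. -/
def fPD3 : HubFn3 := ind3 hPD3
/-- `D_o = P(PD, o ∈ U)`. -/
def fDo3 : HubFn3 := ind3 (hand3 hPD3 o13) + ind3 (hand3 hPD3 o23)
/-- `gap = P(a₂ ↔ b) − P(a₁ ↔ b)`. -/
def fgap3 : HubFn3 := ind3 b23 - ind3 b13
/-- `E_Q[σ_b σ_o]`. -/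
def fEQbo3 : HubFn3 :=
  ind3 (hand3 hQ3 (hand3 o13 b13)) + ind3 (hand3 hQ3 (hand3 o23 b23)) -
    ind3 (hand3 hQ3 (hand3 o23 b13)) - ind3 (hand3 hQ3 (hand3 o13 b23))
/-- `E_Q[σ_b σ₃]`. -/
def fEQb33 : HubFn3 :=
  ind3 (hand3 hT'3 b13) + ind3 (hand3 hT3 b23) - ind3 (hand3 hT3 b13) - ind3 (hand3 hT'3 b23)
/-- `E_Q[σ_b σ₃ 1_{o ∈ U}]`. -/
def fEQb3o3 : HubFn3 :=
  ind3 (hand3 hT'3 (hand3 o13 b13)) + ind3 (hand3 hT'3 (hand3 o23 b13)) +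
    ind3 (hand3 hT3 (hand3 o13 b23)) + ind3 (hand3 hT3 (hand3 o23 b23)) -
    ind3 (hand3 hT3 (hand3 o13 b13)) - ind3 (hand3 hT3 (hand3 o23 b13)) -
    ind3 (hand3 hT'3 (hand3 o13 b23)) - ind3 (hand3 hT'3 (hand3 o23 b23))
/-- `E_Q[σ_o]`. -/
def fEQo3 : HubFn3 := ind3 (hand3 hQ3 o13) - ind3 (hand3 hQ3 o23)
/-- `E_Q[σ₃]`. -/
def fEQ33 : HubFn3 := ind3 hT'3 - ind3 hT3
/-- `E_Q[σ₃ 1_{o ∈ U}]`. -/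
def fEQ3o3 : HubFn3 :=
  ind3 (hand3 hT'3 o13) + ind3 (hand3 hT'3 o23) - ind3 (hand3 hT3 o13) - ind3 (hand3 hT3 o23)
/-- `P(PD, b ∈ U)`. -/
def fPDb3 : HubFn3 := ind3 (hand3 hPD3 b13) + ind3 (hand3 hPD3 b23)
/-- `P(PD, b ∈ U, o ∈ U)`. -/
def fPDbo3 : HubFn3 :=
  ind3 (hand3 hPD3 (hand3 o13 b13)) + ind3 (hand3 hPD3 (hand3 o23 b13)) +
    ind3 (hand3 hPD3 (hand3 o13 b23)) + ind3 (hand3 hPD3 (hand3 o23 b23))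

variable {R : Type*} [CommRing R]

/-- **`Gc` as a cubic in the Bernstein-1 masses of the twelve hub functions** (the nested
formula of HCov.lean with `P(·)` replaced by `massZ3 q · m`). -/
def GcB3 (q : Fin 4 → R) (m : (Fin 6 → Bool) → R) : R :=
  massZ3 q fQ3 m * (massZ3 q fPD3 m * massZ3 q fEQbo3 m + massZ3 q fDo3 m * massZ3 q fEQb33 m -
      massZ3 q fPD3 m * massZ3 q fEQb3o3 m) +
    massZ3 q fgap3 m * (massZ3 q fPD3 m * massZ3 q fEQo3 m + massZ3 q fDo3 m * massZ3 q fEQ33 m -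
      massZ3 q fPD3 m * massZ3 q fEQ3o3 m) +
    massZ3 q fQ3 m * (massZ3 q fDo3 m * massZ3 q fPDb3 m - massZ3 q fPD3 m * massZ3 q fPDbo3 m)

end Forms

section Main

variable {R : Type*} [Field R] [Fintype E] [DecidableEq E] [DecidableEq V]

/-- **`Gc = GcB3`** on the class R₃: the covariance form is the cubic `GcB3` in the a₃-bundle
weights `q = bundleWeight3` and the inner masses `m_π = P(Π = π)`. -/
theorem Gc_eq_GcB3 (p : E → R) (ends : E → Sym2 V) (o a₁ a₂ a₃ b : V)
    (hinj : Function.Injective (markOf3 o a₁ a₂ a₃ b)) (hR : ClassR3 ends (markOf3 o a₁ a₂ a₃ b))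
    (m : (Fin 6 → Bool) → R)
    (hm : ∀ π, prob p {ω | innerPat3 ends (markOf3 o a₁ a₂ a₃ b) ω = π} = m π) :
    CovForm.Gc p ends o a₁ a₂ a₃ b = GcB3 (bundleWeight3 p ends (markOf3 o a₁ a₂ a₃ b)) m := by
  have h12 : connEvent ends a₁ a₂ = toEvent3 ends (markOf3 o a₁ a₂ a₃ b) (cE3 .a₁ .a₂) :=
    connEvent_eq_toEvent3 hinj hR .a₁ .a₂
  have h21 : connEvent ends a₂ a₁ = toEvent3 ends (markOf3 o a₁ a₂ a₃ b) (cE3 .a₂ .a₁) :=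
    connEvent_eq_toEvent3 hinj hR .a₂ .a₁
  have h1o : connEvent ends a₁ o = toEvent3 ends (markOf3 o a₁ a₂ a₃ b) o13 :=
    connEvent_eq_toEvent3 hinj hR .a₁ .o
  have h2o : connEvent ends a₂ o = toEvent3 ends (markOf3 o a₁ a₂ a₃ b) o23 :=
    connEvent_eq_toEvent3 hinj hR .a₂ .o
  have h1b : connEvent ends a₁ b = toEvent3 ends (markOf3 o a₁ a₂ a₃ b) b13 :=
    connEvent_eq_toEvent3 hinj hR .a₁ .b
  have h2b : connEvent ends a₂ b = toEvent3 ends (markOf3 o a₁ a₂ a₃ b) b23 :=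
    connEvent_eq_toEvent3 hinj hR .a₂ .b
  have h13 : connEvent ends a₁ a₃ = toEvent3 ends (markOf3 o a₁ a₂ a₃ b) (cE3 .a₁ .a₃) :=
    connEvent_eq_toEvent3 hinj hR .a₁ .a₃
  have h23 : connEvent ends a₂ a₃ = toEvent3 ends (markOf3 o a₁ a₂ a₃ b) (cE3 .a₂ .a₃) :=
    connEvent_eq_toEvent3 hinj hR .a₂ .a₃
  have h31 : connEvent ends a₃ a₁ = toEvent3 ends (markOf3 o a₁ a₂ a₃ b) (cE3 .a₃ .a₁) :=
    connEvent_eq_toEvent3 hinj hR .a₃ .a₁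
  have h32 : connEvent ends a₃ a₂ = toEvent3 ends (markOf3 o a₁ a₂ a₃ b) (cE3 .a₃ .a₂) :=
    connEvent_eq_toEvent3 hinj hR .a₃ .a₂
  have hQe : avoidAll ends a₂ {a₁} = toEvent3 ends (markOf3 o a₁ a₂ a₃ b) hQ3 := by
    rw [avoidAll_singleton_eq3, h21, ← toEvent3_not]
    rfl
  have hTe : TEvent ends a₁ a₂ a₃ = toEvent3 ends (markOf3 o a₁ a₂ a₃ b) hT3 := by
    rw [TEvent, h21, h23, ← toEvent3_not, ← toEvent3_and]
    rfl
  have hT'e : TEvent ends a₂ a₁ a₃ = toEvent3 ends (markOf3 o a₁ a₂ a₃ b) hT'3 := by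
    rw [TEvent, h12, h13, ← toEvent3_not, ← toEvent3_and]
    rfl
  have hPDe : PDEvent ends a₁ a₂ a₃ = toEvent3 ends (markOf3 o a₁ a₂ a₃ b) hPD3 := by
    rw [PDEvent, Dtilde, inU, h12, h31, h32, ← toEvent3_or, ← toEvent3_not, ← toEvent3_not,
      ← toEvent3_and]
    rfl
  have hand' : ∀ Ψ₁ Ψ₂ : HubEvt3, toEvent3 ends (markOf3 o a₁ a₂ a₃ b) Ψ₁ ∩
      toEvent3 ends (markOf3 o a₁ a₂ a₃ b) Ψ₂ =
        toEvent3 ends (markOf3 o a₁ a₂ a₃ b) (hand3 Ψ₁ Ψ₂) :=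
    fun Ψ₁ Ψ₂ => (toEvent3_and _ _ Ψ₁ Ψ₂).symm
  unfold CovForm.Gc CovForm.DEF CovForm.EQbo CovForm.EQb3 CovForm.EQb3o CovForm.EQo CovForm.EQ3
    CovForm.EQ3o CovForm.PDb CovForm.PDbo CovForm.Do CovForm.gap
  rw [hQe, hTe, hT'e, hPDe, h1o, h2o, h1b, h2b]
  simp only [hand', prob_toEvent3_eq_massZ3 hinj p m hm]
  unfold GcB3 fQ3 fPD3 fDo3 fgap3 fEQbo3 fEQb33 fEQb3o3 fEQo3 fEQ33 fEQ3o3 fPDb3 fPDbo3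
  simp only [massZ3_add, massZ3_sub]

end Main

section Table

variable {R : Type*} [CommRing R]

/-- A coefficient tensor on triples of inner patterns. -/
abbrev Tensor3 := (Fin 6 → Bool) → (Fin 6 → Bool) → (Fin 6 → Bool) → ℤ

/-- **The integer hub table of three hub functions**:
`Σ_{prof w₁ w₂ w₃ = k} Φ₁ w₁ π₁ · Φ₂ w₂ π₂ · Φ₃ w₃ π₃`. -/
def wZ3 (Φ₁ Φ₂ Φ₃ : HubFn3) (k : Fin 4 → Fin 4) : Tensor3 := fun π₁ π₂ π₃ =>
  ∑ t : (Fin 4 → Bool) × (Fin 4 → Bool) × (Fin 4 → Bool) with prof t.1 t.2.1 t.2.2 = k,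
    Φ₁ t.1 π₁ * Φ₂ t.2.1 π₂ * Φ₃ t.2.2 π₃

/-- The cubic in the inner masses with coefficient tensor `W`. -/
def cub3 (W : Tensor3) (m : (Fin 6 → Bool) → R) : R :=
  ∑ π₁, ∑ π₂, ∑ π₃, (W π₁ π₂ π₃ : R) * (m π₁ * m π₂ * m π₃)

/-- Cubics are additive in the tensor. -/
lemma cub3_add (W₁ W₂ : Tensor3) (m : (Fin 6 → Bool) → R) :
    cub3 (W₁ + W₂) m = cub3 W₁ m + cub3 W₂ m := by
  simp only [cub3, Pi.add_apply, Int.cast_add, add_mul, Finset.sum_add_distrib]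

/-- Cubics are subtractive in the tensor. -/
lemma cub3_sub (W₁ W₂ : Tensor3) (m : (Fin 6 → Bool) → R) :
    cub3 (W₁ - W₂) m = cub3 W₁ m - cub3 W₂ m := by
  simp only [cub3, Pi.sub_apply, Int.cast_sub, sub_mul, Finset.sum_sub_distrib]

/-- **The Bernstein coefficient of three hub masses is the cubic of the integer hub table.** -/
theorem coef3_tableZ3 (Φ₁ Φ₂ Φ₃ : HubFn3) (m : (Fin 6 → Bool) → R) (k : Fin 4 → Fin 4) :
    coef3 (tableZ3 Φ₁ m) (tableZ3 Φ₂ m) (tableZ3 Φ₃ m) k = cub3 (wZ3 Φ₁ Φ₂ Φ₃ k) m := by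
  unfold coef3 tableZ3 wZ3 cub3
  simp only [sum_mul_sum_mul_sum]
  simp only [Int.cast_sum, Finset.sum_mul]
  conv_lhs => rw [Finset.sum_comm]
  refine Finset.sum_congr rfl fun π₁ _ => ?_
  conv_lhs => rw [Finset.sum_comm]
  refine Finset.sum_congr rfl fun π₂ _ => ?_
  conv_lhs => rw [Finset.sum_comm]
  refine Finset.sum_congr rfl fun π₃ _ => Finset.sum_congr rfl fun t _ => ?_
  push_cast
  ring

/-- A product of three hub masses is a degree-3 Bernstein form with cubic coefficients. -/
theorem massZ3_mul_mul (q : Fin 4 → R) (Φ₁ Φ₂ Φ₃ : HubFn3) (m : (Fin 6 → Bool) → R) :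
    massZ3 q Φ₁ m * massZ3 q Φ₂ m * massZ3 q Φ₃ m =
      ∑ k, bern q k * cub3 (wZ3 Φ₁ Φ₂ Φ₃ k) m := by
  unfold massZ3
  rw [bform_mul_mul]
  exact Finset.sum_congr rfl fun k _ => by rw [coef3_tableZ3]

/-- **The a₃-hub table `W_k`**: the signed sum of the eight tables of `GcB3`. -/
def Wtot3 (k : Fin 4 → Fin 4) : Tensor3 :=
  wZ3 fQ3 fPD3 fEQbo3 k + wZ3 fQ3 fDo3 fEQb33 k - wZ3 fQ3 fPD3 fEQb3o3 k +
    wZ3 fgap3 fPD3 fEQo3 k + wZ3 fgap3 fDo3 fEQ33 k - wZ3 fgap3 fPD3 fEQ3o3 k +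
    wZ3 fQ3 fDo3 fPDb3 k - wZ3 fQ3 fPD3 fPDbo3 k

/-- **The coefficient cubic `C_k(m)`** of the type vector `k`. -/
def Ck3 (m : (Fin 6 → Bool) → R) (k : Fin 4 → Fin 4) : R := cub3 (Wtot3 k) m

/-- `GcB3` as the signed sum of its eight triple products. -/
lemma GcB3_eq_triples (q : Fin 4 → R) (m : (Fin 6 → Bool) → R) :
    GcB3 q m =
      massZ3 q fQ3 m * massZ3 q fPD3 m * massZ3 q fEQbo3 m +
        massZ3 q fQ3 m * massZ3 q fDo3 m * massZ3 q fEQb33 m -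
        massZ3 q fQ3 m * massZ3 q fPD3 m * massZ3 q fEQb3o3 m +
        massZ3 q fgap3 m * massZ3 q fPD3 m * massZ3 q fEQo3 m +
        massZ3 q fgap3 m * massZ3 q fDo3 m * massZ3 q fEQ33 m -
        massZ3 q fgap3 m * massZ3 q fPD3 m * massZ3 q fEQ3o3 m +
        massZ3 q fQ3 m * massZ3 q fDo3 m * massZ3 q fPDb3 m -
        massZ3 q fQ3 m * massZ3 q fPD3 m * massZ3 q fPDbo3 m := by
  unfold GcB3
  ring

/-- **The Bernstein–hub expansion**: `GcB3 q m = Σ_k bern q k · C_k(m)`. -/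
theorem GcB3_eq_sum (q : Fin 4 → R) (m : (Fin 6 → Bool) → R) :
    GcB3 q m = ∑ k, bern q k * Ck3 m k := by
  rw [GcB3_eq_triples]
  simp only [massZ3_mul_mul, ← Finset.sum_add_distrib, ← Finset.sum_sub_distrib]
  refine Finset.sum_congr rfl fun k _ => ?_
  unfold Ck3 Wtot3
  simp only [cub3_add, cub3_sub]
  ring

end Table

section Nonneg

variable {R : Type*} [CommRing R] [PartialOrder R] [IsOrderedRing R]

/-- **Positivity of `GcB3` from positivity of the coefficient cubics**: if `q ∈ [0, 1]^4` and
`C_k(m) ≥ 0` for every type vector `k`, then `GcB3 q m ≥ 0`. -/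
theorem GcB3_nonneg {q : Fin 4 → R} (hq : ∀ i, 0 ≤ q i ∧ q i ≤ 1) {m : (Fin 6 → Bool) → R}
    (hC : ∀ k, 0 ≤ Ck3 m k) : 0 ≤ GcB3 q m := by
  rw [GcB3_eq_sum]
  exact Finset.sum_nonneg fun k _ => mul_nonneg (bern_nonneg hq k) (hC k)

end Nonneg

end Summit.Ventures.PercRepro2.Hub3
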